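import Literature.AnabelianGeometry.AbsoluteAnabelian.AbsTopIThm26vAlmostProSigmaRegime
import Literature.AnabelianGeometry.AbsoluteAnabelian.AbsTopIThm26vFullResidual
import Literature.AnabelianGeometry.AbsoluteAnabelian.AbsTopII.Remark332ProSigmaProofs
import Literature.AnabelianGeometry.AbsoluteAnabelian.AbsTopIAlmostProSigmaClosers
import HarnessLib

/-!
# [AbsTopI] §2 over an ALMOST pro-`Σ` `Δ`: the remaining pro-`Σ`-only consumers re-keyed (sweep)

S. Mochizuki, *Topics in Absolute Anabelian Geometry I: Generalities* (2012) [AbsTopI] (lit key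
`paper:url-11ac98ba15fc`), Def 1.1 (iii) p. 10, Def 2.1 (i) p. 17, Thm 2.6 p. 21–22; *Topics in Absolute Anabelian
Geometry II* (2013) [AbsTopII], Rmk 3.3.2 p. 69.

PROOF-ONLY sweep (abc-iut-w6-d071, L4 row «PROSIGMA-CONSUMERS-REKEY», L4-lead 13:02:34Z): after
`AbsTopIAlmostProSigmaBridge` (p444875), `AbsTopIThm26vAlmostProSigma` (p445880), `AbsTopIThm26iiiClauseOneAlmostPro`
(p446500), `AbsTopIThm26vAlmostProSigmaRegime` (p446771) and abc-iut-w6-d075's `AbsTopIAlmostProSigmaClosers` (p446584: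
`thm26i_of_isFreeProcyclic_of_isAlmostPro`, `thm26ii_of_starCondition_of_isAlmostPro`, the (iii) clause-2 hooks), the
typed [AbsTopI] §2 / [AbsTopII] Rmk 3.3.2 consumers still keyed ONLY on «`Δ` pro-`Σ`» (`IsProSet E.geom S`) were:

* `geom_eq_iInf_ker_of_isFreeProcyclic_of_isProSet`, `preservesGeom_of_isFreeProcyclic_of_isProSet` (Thm 2.6 (i),
  FF base, characterization clause / "`Δ ⊆ Π` is group-theoretic") → `…_of_isAlmostPro` (mechanism (M1)+(M3));
* `forall_isOpen_thetaSet_two_subset_of_isProSet`, `not_thm26iii_insert_of_isProSet` (Thm 2.6 (iii): clause 1 at all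
  open `H`, the non-monotonicity finding F-w6d073-1) → `…_of_isAlmostPro` (from `thetaSet_two_subset_of_isAlmostPro`,
  corestriction route; the residual form `thm26iii_iff_of_isAlmostPro` is abc-iut-w6-d075's, p447075);
* `MLFBase.thm26vFull_of_isProSet_of_subset`, `MLFBase.thm26vFull_of_hook` (Thm 2.6 (v) modulo the INCLUSION form of
  (iii) clause 2 / from the Lemma 2.7 (iii) hook) → `…_of_isAlmostPro_of_subset`, `…_of_hook_of_isAlmostPro`;
* `AbsTopII.rmk_3_3_2_MLF_of_isProSet` ([AbsTopII] Rmk 3.3.2, MLF base, `Σ ≠ 𝔓𝔯𝔦𝔪𝔢𝔰`) →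
  `AbsTopII.rmk_3_3_2_MLF_of_isAlmostPro` (the pro-`Σ` class is a subclass: `IsProSet.isAlmostPro`).

So no lineage keeps a pro-`Σ`-only door: every closer now also accepts the HONEST Def 2.1 (i) datum (`Δ` almost
pro-`Σ`; the GFG construction IS such, `GFGSurfaceModel.isAlmostPro`).  Nothing of the landed files is edited.
HONEST SCOPE: refereed, undisputed statements; classical profinite group theory / Galois cohomology; OUR kernel check;
nothing here bears on [IUTchIII] Cor. 3.12; no side is taken.
-/

noncomputable section

open Topology

namespace Literature.AnabelianGeometry.AbsoluteAnabelian

universe u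

namespace FundamentalExtension

/-! ### Thm 2.6 (i): the characterization clause and "`Δ ⊆ Π` is group-theoretic", FF base -/

section ThmOne

variable (E : FundamentalExtension.{u}) {F : FundamentalExtension.{u}}

/-- `⊤ ⊆ Π` is open. [folklore] -/
private theorem isOpen_top' : IsOpen ((⊤ : Subgroup E.arith) : Set E.arith) := by
  rw [Subgroup.coe_top]
  exact isOpen_univ

/-- **Thm 2.6 (i), characterization clause, `Δ` ALMOST pro-`Σ`**: GIVEN `G ≅ Ẑ` and the Tate-module input at the
primes `l ∈ Σ` only, `Δ` is the common kernel of the continuous `Π → ℤ_l` — for `l ∉ Σ` every continuous character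
of the almost pro-`Σ` group `Δ ∩ ⊤` is trivial ((M1)+(M3)). [cite: MochizukiAbsTopI2012, Thm 2.6 (i) p.21] -/
theorem geom_eq_iInf_ker_of_isFreeProcyclic_of_isAlmostPro (hG : IsFreeProcyclic E.gal) (S : Set ℕ)
    (hpro : IsAlmostPro E.geom S)
    (hT : ∀ (l : ℕ) [Fact l.Prime], l ∈ S → ∀ (ψ : ↥(E.geom ⊓ ⊤) →ₜ* Multiplicative ℤ_[l]),
      (∀ g ∈ (⊤ : Subgroup E.arith), ∀ (d d' : ↥(E.geom ⊓ ⊤)),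
        (d' : E.arith) = g * d * g⁻¹ → ψ d' = ψ d) → ∀ d, ψ d = 1) :
    E.geom = ⨅ (l : ℕ) (_ : Fact l.Prime) (φ : E.arith →ₜ* Multiplicative ℤ_[l]),
      φ.toMonoidHom.ker := by
  haveI : CompactSpace ↥(E.geom ⊓ ⊤) :=
    isCompact_iff_compactSpace.mp (E.isClosed_geom.inter ((⊤ : Subgroup E.arith).isClosed_of_isOpen
      E.isOpen_top')).isCompact
  refine E.geom_eq_iInf_ker_of_isFreeProcyclic hG fun l _ ψ hψ d => ?_
  by_cases hl : l ∈ S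
  · exact hT l hl ψ hψ d
  · exact (E.isAlmostPro_geom_inf_of_isOpen hpro ⊤ E.isOpen_top').apply_padicInt_eq_one hl ψ d

variable {E}

/-- **Thm 2.6 (i) ⟹ "`Δ ⊆ Π` is group-theoretic", `Δ_E`, `Δ_F` ALMOST pro-`Σ_E` / pro-`Σ_F`** (sharp form: Tate
input at the primes of `Σ` only, no Prop 2.2): every `φ : Π_E ⥲ Π_F` carries `Δ_E` onto `Δ_F`.
[cite: MochizukiAbsTopI2012, Thm 2.6 (i) p.21] -/
theorem preservesGeom_of_isFreeProcyclic_of_isAlmostPro (hGE : IsFreeProcyclic E.gal)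
    (hGF : IsFreeProcyclic F.gal) (S T : Set ℕ) (hproE : IsAlmostPro E.geom S)
    (hproF : IsAlmostPro F.geom T)
    (hTE : ∀ (l : ℕ) [Fact l.Prime], l ∈ S → ∀ (ψ : ↥(E.geom ⊓ ⊤) →ₜ* Multiplicative ℤ_[l]),
      (∀ g ∈ (⊤ : Subgroup E.arith), ∀ (d d' : ↥(E.geom ⊓ ⊤)),
        (d' : E.arith) = g * d * g⁻¹ → ψ d' = ψ d) → ∀ d, ψ d = 1)
    (hTF : ∀ (l : ℕ) [Fact l.Prime], l ∈ T → ∀ (ψ : ↥(F.geom ⊓ ⊤) →ₜ* Multiplicative ℤ_[l]),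
      (∀ g ∈ (⊤ : Subgroup F.arith), ∀ (d d' : ↥(F.geom ⊓ ⊤)),
        (d' : F.arith) = g * d * g⁻¹ → ψ d' = ψ d) → ∀ d, ψ d = 1)
    (φ : E.arith ≃ₜ* F.arith) : PreservesGeom φ :=
  preservesGeom_of_eq_iInf_ker (E.geom_eq_iInf_ker_of_isFreeProcyclic_of_isAlmostPro hGE S hproE hTE)
    (F.geom_eq_iInf_ker_of_isFreeProcyclic_of_isAlmostPro hGF T hproF hTF) φ

end ThmOne

/-! ### Thm 2.6 (iii): clause 1 at all open subgroups, the residual form, non-monotonicity -/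

variable (E : FundamentalExtension.{0})

/-- **Thm 2.6 (iii) clause 1 for all open subgroups at once, `Δ` ALMOST pro-`Σ`** — the first conjunct of the
input `hiii` of the (v) closers. [cite: MochizukiAbsTopI2012, Thm 2.6 (iii) p.22] -/
theorem forall_isOpen_thetaSet_two_subset_of_isAlmostPro (B : E.MLFBase) {S : Set ℕ}
    (htfg : IsTopologicallyFinitelyGenerated E.arith) (hpro : IsAlmostPro E.geom S) :
    ∀ H : Subgroup E.arith, IsOpen (H : Set E.arith) → thetaSet ↥H 2 ⊆ {l ∈ S | l.Prime} :=
  fun H hH => MLFBase.thetaSet_two_subset_of_isOpen_of_isAlmostPro B htfg hpro H hH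

/-- **The typed `Thm26iii E S` is not monotone in `S`, also over the almost pro-`Σ` datum** (finding F-w6d073-1
persists: `IsAlmostPro E.geom S` survives `insert l₁ S`, while `θ²(Π)` is intrinsic).
[cite: MochizukiAbsTopI2012, Thm 2.6 (iii) p.22] -/
theorem not_thm26iii_insert_of_isAlmostPro (B : E.MLFBase) {S : Set ℕ}
    (htfg : IsTopologicallyFinitelyGenerated E.arith) (hpro : IsAlmostPro E.geom S)
    (hθ : 2 ≤ (thetaSet E.arith 1).encard) {l₁ : ℕ} (hl₁ : l₁.Prime) (hl₁S : l₁ ∉ S) :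
    ¬ E.Thm26iii (insert l₁ S) := by
  intro h
  have hmem : l₁ ∈ thetaSet E.arith 2 := by
    rw [h.2 hθ]
    exact ⟨Set.mem_insert l₁ S, hl₁⟩
  exact hl₁S (E.thetaSet_two_subset_of_isAlmostPro B htfg hpro hmem).1

variable {E}

/-! ### Thm 2.6 (v) modulo the inclusion form of (iii) clause 2 -/

/-- **Thm 2.6 (v), general form, modulo the INCLUSION form of (iii) clause two, `Δ` ALMOST pro-`Σ`** (twin of
`MLFBase.thm26vFull_of_isProSet_of_subset`). [cite: MochizukiAbsTopI2012, Thm 2.6 (v) p.22] -/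
theorem MLFBase.thm26vFull_of_isAlmostPro_of_subset (B : E.MLFBase) (S : Set ℕ)
    (hS : S ⊆ {q | q.Prime}) (hΔ : E.GeomTFG) (htfg : IsTopologicallyFinitelyGenerated E.arith)
    (hΔS : IsAlmostPro E.geom S)
    (hQ : (∀ q : ℕ, q.Prime → q ∈ S) → ∀ (P : Subgroup E.arith), IsOpen (P : Set E.arith) →
      ∃ m : ℕ, ∀ (l : ℕ) [Fact l.Prime],
        freeProlRank P l = freeProlRank (P.map E.aug.toMonoidHom) l + m)
    (hL : (∀ q : ℕ, q.Prime → q ∈ S) → ∀ (H : Subgroup E.arith), IsOpen (H : Set E.arith) →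
      2 ≤ (thetaSet H 1).encard → {l ∈ S | l.Prime} ⊆ thetaSet H 2) :
    E.Thm26vFull B := by
  refine MLFBase.thm26vFull_of_isAlmostPro_of_tfg B S hS hΔ htfg hΔS hQ fun hall H hH h2 => ?_
  refine Set.Subset.antisymm (thetaSet_subset_primes H 2) fun l hl => ?_
  exact hL hall H hH h2 ⟨hall l hl, hl⟩

/-- **Thm 2.6 (v), GENERAL form, for EVERY `Σ ⊆ 𝔓𝔯𝔦𝔪𝔢𝔰, from the Lemma 2.7 (iii) hook, `Δ` ALMOST pro-`Σ`** (twin of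
`MLFBase.thm26vFull_of_hook`): inputs `Δ` tfg, `Π` tfg, `Δ` almost pro-`Σ`, the hook (abc-iut-w6-d075's
`MLFBase.subset_thetaSet_two_of_hook_of_isAlmostPro`, p446584), and — only when `Σ ⊇ 𝔓𝔯𝔦𝔪𝔢𝔰` — the rank identity of
(ii) for every open `Π′`. [cite: MochizukiAbsTopI2012, Thm 2.6 (v) p.22] -/
theorem MLFBase.thm26vFull_of_hook_of_isAlmostPro (B : E.MLFBase) (S : Set ℕ) (hS : S ⊆ {q | q.Prime})
    (hΔ : E.GeomTFG) (htfg : IsTopologicallyFinitelyGenerated E.arith) (hΔS : IsAlmostPro E.geom S)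
    (hQ : (∀ q : ℕ, q.Prime → q ∈ S) → ∀ (P : Subgroup E.arith), IsOpen (P : Set E.arith) →
      ∃ m : ℕ, ∀ (l : ℕ) [Fact l.Prime],
        freeProlRank P l = freeProlRank (P.map E.aug.toMonoidHom) l + m)
    (hook : ∀ (J : Subgroup E.arith), IsOpen (J : Set E.arith) →
      (∃ (l₀ : ℕ) (_ : Fact l₀.Prime), l₀ ∈ S ∧
        freeProlRank (J.map E.aug.toMonoidHom) l₀ < freeProlRank J l₀) →
      {l ∈ S | l.Prime} ⊆ thetaSet J 2) :
    E.Thm26vFull B :=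
  MLFBase.thm26vFull_of_isAlmostPro_of_subset B S hS hΔ htfg hΔS hQ fun _ H hH h2 =>
    MLFBase.subset_thetaSet_two_of_hook_of_isAlmostPro B hΔS hook H hH h2

end FundamentalExtension

/-! ### [AbsTopII] Remark 3.3.2, MLF base, `Σ ≠ 𝔓𝔯𝔦𝔪𝔢𝔰`, over the almost pro-`Σ` class -/

namespace AbsTopII

open FundamentalExtension

/-- **[AbsTopII] Remark 3.3.2, `k` an MLF, `Δ` ALMOST pro-`Σ` with `Σ ≠ 𝔓𝔯𝔦𝔪𝔢𝔰` — UNCONDITIONAL.**  On the class of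
extensions with MLF base data, `Δ` topologically finitely generated and ALMOST pro-`Σ` for some `Σ ⊊ 𝔓𝔯𝔦𝔪𝔢𝔰` (the
Def 2.1 (i) datum), every `Π_E ⥲ Π_F` carries `Δ_E` onto `Δ_F` ([AbsTopI] Thm 2.6 (iv),
`MLFBase.preservesGeom_of_isAlmostPro`).  The landed pro-`Σ` class (`rmk_3_3_2_MLF_of_isProSet`) is a subclass
(`IsProSet.isAlmostPro`). [cite: MochizukiAbsTopII2013, Rmk 3.3.2 p.69] [cite: MochizukiAbsTopI2012, Thm 2.6 (iv) p.22] -/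
theorem rmk_3_3_2_MLF_of_isAlmostPro :
    Rmk_3_3_2 {E : FundamentalExtension.{0} | ∃ _B : E.MLFBase, E.GeomTFG ∧
      ∃ S : Set ℕ, S ⊆ {q | q.Prime} ∧ S ≠ {q | q.Prime} ∧ IsAlmostPro E.geom S} := by
  intro E hE F hF φ
  obtain ⟨BE, hΔE, S, hS, hS', hES⟩ := hE
  obtain ⟨BF, hΔF, T, hT, hT', hFT⟩ := hF
  exact MLFBase.preservesGeom_of_isAlmostPro BE BF hΔE hΔF hS hS' hES hT hT' hFT φ

/-- Monotonicity form: Remark 3.3.2 on any subclass of the almost pro-`Σ` class (e.g. the pro-`Σ` class, or the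
class of Def 2.1 (i) GFG constructions). [cite: MochizukiAbsTopII2013, Rmk 3.3.2 p.69] -/
theorem rmk_3_3_2_mono_MLF_of_isAlmostPro {𝒦 : Set FundamentalExtension.{0}}
    (h𝒦 : 𝒦 ⊆ {E : FundamentalExtension.{0} | ∃ _B : E.MLFBase, E.GeomTFG ∧
      ∃ S : Set ℕ, S ⊆ {q | q.Prime} ∧ S ≠ {q | q.Prime} ∧ IsAlmostPro E.geom S}) : Rmk_3_3_2 𝒦 :=
  rmk_3_3_2_MLF_of_isAlmostPro.mono h𝒦

/-- The pro-`Σ` class of `rmk_3_3_2_MLF_of_isProSet` lies in the almost pro-`Σ` class (so that theorem is a case of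
`rmk_3_3_2_MLF_of_isAlmostPro`). [cite: MochizukiAbsTopII2013, Rmk 3.3.2 p.69] -/
theorem proSet_class_subset_almostPro_class :
    {E : FundamentalExtension.{0} | ∃ _B : E.MLFBase, E.GeomTFG ∧
        ∃ S : Set ℕ, S ⊆ {q | q.Prime} ∧ S ≠ {q | q.Prime} ∧ IsProSet E.geom S} ⊆
      {E : FundamentalExtension.{0} | ∃ _B : E.MLFBase, E.GeomTFG ∧
        ∃ S : Set ℕ, S ⊆ {q | q.Prime} ∧ S ≠ {q | q.Prime} ∧ IsAlmostPro E.geom S} := by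
  rintro E ⟨B, hΔ, S, hS, hS', hES⟩
  exact ⟨B, hΔ, S, hS, hS', hES.isAlmostPro⟩

end AbsTopII

end Literature.AnabelianGeometry.AbsoluteAnabelian

end
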